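import Mathlib
import Literature.AlgebraicGeometry.Resolution.LocalBlowup
import HarnessLib

/-!
# A generator of minimal value in a nonzero finitely generated ideal

Crux `HomologicalConductor.Persistence` (stmt-ResolutionOfSingularities-16484), line `birth`,
registered stub `stub_exists_minimal`.

Inside a field `K` with a valuation ring `O ⊆ K`, let `B ⊆ O` be a `k`-subalgebra of `K` and
`I` a nonzero finitely generated ideal of `↥B`.  Then some `x ∈ I` with `x ≠ 0` has *minimal
value* on `I`: `c * x⁻¹ ∈ O` for every `c ∈ I`.  Proof: among the finitely many generators of
`I` (not all zero, since `I ≠ ⊥`) pick one, `x`, of maximal `O.valuation` (tree lemma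
`Literature.AlgebraicGeometry.Resolution.exists_max_valuation`); every `c = Σ bᵢ gᵢ ∈ I` has
`O.valuation c ≤ max O.valuation (bᵢ gᵢ) ≤ O.valuation x` by the ultrametric inequality and
`O.valuation bᵢ ≤ 1` (`B ⊆ O`), whence `O.valuation (c * x⁻¹) ≤ 1`, i.e. `c * x⁻¹ ∈ O`.
This is the choice of chart in the local blowing up along an ideal
(Novacoski–Spivakovsky, Def. 2.11; the `Subring` form is the tree's
`exists_isLocalBlowupAlong`).  All folklore.
-/

-- single-problem summit: the doubled namespace component is forced
set_option linter.dupNamespace false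

noncomputable section

namespace Summit.ResolutionOfSingularities.ResolutionOfSingularities.Theorems.HomologicalConductor.PersistenceExistsMinimal

open Literature.AlgebraicGeometry.Resolution (exists_max_valuation)

/-- **Ultrametric bound on an ideal from its generators.** If `B ⊆ O` and every element of a
set `s ⊆ ↥B` of generators has `O.valuation` at most `g`, then so does every element of the
ideal `Ideal.span s`: for `c = Σ bᵢ gᵢ`, `v c ≤ max v (bᵢ gᵢ) ≤ max v gᵢ ≤ g` since
`v bᵢ ≤ 1`. [folklore] -/
theorem valuation_le_of_mem_span {k K : Type} [Field k] [Field K] [Algebra k K]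
    {O : ValuationSubring K} {B : Subalgebra k K} (hB : B.toSubring ≤ O.toSubring)
    {s : Set ↥B} {g : O.ValueGroup}
    (hs : ∀ x ∈ s, O.valuation (x : K) ≤ g) {c : ↥B} (hc : c ∈ Ideal.span s) :
    O.valuation (c : K) ≤ g := by
  induction hc using Submodule.span_induction with
  | mem x hx => exact hs x hx
  | zero => simp
  | add x y _ _ hx hy =>
    rw [Subalgebra.coe_add]
    exact Valuation.map_add_le _ hx hy
  | smul a x _ hx =>
    rw [smul_eq_mul, Subalgebra.coe_mul, map_mul]
    have ha : O.valuation (a : K) ≤ 1 := (O.valuation_le_one_iff _).mpr (hB a.2)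
    calc O.valuation (a : K) * O.valuation (x : K) ≤ 1 * g := mul_le_mul' ha hx
      _ = g := one_mul g

/-- **A generator of minimal value.** For a `k`-subalgebra `B ⊆ O` of `K` (`O` a valuation ring
of `K`) and a nonzero finitely generated ideal `I` of `↥B`, some nonzero `x ∈ I` divides every
element of `I` inside `O`: `c * x⁻¹ ∈ O` for all `c ∈ I` (equivalently `ν(x) = min ν(I)`).
Take a generator of maximal `O.valuation`. [folklore] -/
theorem stub_exists_minimal : ∀ (k K : Type) [Field k] [Field K] [Algebra k K]
    (O : ValuationSubring K) (B : Subalgebra k K), B.toSubring ≤ O.toSubring →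
    ∀ I : Ideal ↥B, I.FG → I ≠ ⊥ →
    ∃ x ∈ I, (x : K) ≠ 0 ∧ ∀ c ∈ I, (c : K) * ((x : K))⁻¹ ∈ O := by
  intro k K _ _ _ O B hB I hI hI0
  classical
  obtain ⟨u, hu⟩ := hI
  have hne : ∃ x ∈ u, ((x : ↥B) : K) ≠ 0 := by
    by_contra! hcon
    apply hI0
    rw [← hu, Ideal.span_eq_bot]
    intro x hx
    exact Subtype.ext (hcon x hx)
  obtain ⟨x, hxu, hx0, hmax⟩ := exists_max_valuation O u (fun x : ↥B => (x : K)) hne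
  refine ⟨x, hu ▸ Ideal.subset_span hxu, hx0, fun c hc => ?_⟩
  have hv : O.valuation (c : K) ≤ O.valuation (x : K) :=
    valuation_le_of_mem_span hB hmax (hu ▸ hc)
  have hvx : O.valuation (x : K) ≠ 0 := by rwa [ne_eq, map_eq_zero]
  rw [← O.valuation_le_one_iff, map_mul, map_inv₀]
  calc O.valuation (c : K) * (O.valuation (x : K))⁻¹
      ≤ O.valuation (x : K) * (O.valuation (x : K))⁻¹ := mul_le_mul' hv le_rfl
    _ = 1 := mul_inv_cancel₀ hvx

end Summit.ResolutionOfSingularities.ResolutionOfSingularities.Theorems.HomologicalConductor.PersistenceExistsMinimal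

end
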